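/-
Copyright (c) 2026 the pub-hodgecm-mathlib formalisation cell (harness21).  Prover seat hodgecm-mathlib-K2Liu-p09 (g2): Track B «K2-LIT», #184♮ = hLiu418,
payer-internal step (br)-geometric of file #34 `Theorems/K2LiuDoublingZetaGL1.lean` (LEAD F0P6-plan (g10) DEAL K2/STATUS 2026-09-04T02:36:29Z;
DEPMAP v2.5 §10 TABLE A row «docking :367–:371» (br)).
-/
import Literature.NumberTheory.Automorphic.UnitaryGroupLocalCongr
import Summits.HodgeConjecture.HodgeConjecture.Theorems.K2LiuDoublingUnfoldBridge
import HarnessLib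

/-!
# Crux `HLiu418`, Track B road `K2_Liu`, file #34 — (br), geometric half: THE DOCKING MAP `ιA` PLACE BY PLACE

Cell `hodgecm-mathlib`, crux item hLiu418 = `stmt-HodgeConjecture-24832`, route of record `HCCMUnconditional`; squad K2 ∕ K2Liu, LEAD F0P6-plan (g10),
prover K2Liu-p09 (g2).  THEOREMS ONLY (no `def`, no instance, no notation, no named-fact hypothesis, no `sorry`, default heartbeats); lane
`--supports stmt-HodgeConjecture-24832 --as helper` (count-neutral).

s23 docks `G = U(H)` into `U(V) = U(diagonal dV)` by `ιA` with the pin `hιA : ιA k = ĝ⁻¹ · k · ĝ` (`hg : ᵗc(g)(t • H)g = diagonal dV`).  ★ #29s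
`doublingPartialEuler` integrates over the local groups of `U(H)`, while the local doubling data (★ #28s, ★ D7 `LambdaLoc`, ★ #31s's factorisation)
live on the local groups of `U(diagonal dV)`; the bridge at a place `v` is the ★ local congruence `localCongr L c g⁻¹ … v : U(H)_v ≃ₜ* U(diag dV)_v`,
`u ↦ g⁻¹ u g` (★ `UnitaryGroupLocalCongr`, «D5»), for the similitude `ᵗc(g⁻¹)(t⁻¹ • diagonal dV)g⁻¹ = H` (`formCongr_inv_diagonal`, from `hg` by ★
`simil_inv_of_formCongr` + ★ `formCongr_inv_smul_of_simil`).  This file proves that `ιA` IS this congruence componentwise: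
* `finPart_iotaA` — `(ιA x)_f = ĝ_f⁻¹ x_f ĝ_f` = ★ `finAdelicCongr … g⁻¹ …` of `x_f` (★ (K5) `finPart_similCongr` + ★ H5 `exists_continuousMulEquiv_eq_iotaA`);
* `evalPlace_finPart_iotaA` — **`(ιA x)_v = localCongr_v (x_v)`** at every finite place `v` (★ (P1) `evalPlace_finAdelicCongr`);
* `exists_archCongr_archPart_iotaA` — `(ιA x)_∞ = Φ∞ (x_∞)` for an isomorphism `Φ∞ : U(H)_∞ ≃ₜ* U(diag dV)_∞` of topological groups (★ (K0∞)(K4));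
* `eventually_localCongr_mem_localInt_iff_inv` — off a finite set of places `localCongr_v` matches the hyperspecial subgroups `U(H)(𝒪_v) ↔ U(diag dV)(𝒪_v)`
  (★ (P2), recorded in the frame of this file).
With these, #31s's factorisation of `f ∘ iotaLeft` on `U(diag dV)(𝔸)` becomes hypothesis (F) of ★ #29s on `U(H)(𝔸)` with
`Λ_v := LambdaLoc_v ∘ iotaLeftLocPi_v ∘ localCongr_v`, and ★ `K2LiuDoublingZetaGL1Transport` carries ★ #28s along `localCongr_v`.

HONEST LABEL: HC_CM is proved only modulo the printed citations (2 remaining named inputs: hLiu418 = stmt-HodgeConjecture-24832,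
h413 = stmt-HodgeConjecture-24833) until rung 0 closes; this file is bookkeeping toward socket s23 and closes no item.
-/

set_option autoImplicit false
set_option linter.dupNamespace false

open scoped Matrix MatrixGroups
open NumberField NumberField.mixedEmbedding IsDedekindDomain Filter

namespace Summit.HodgeConjecture.HodgeConjecture.Cruxes.HLiu418.K2LiuDoublingZetaGL1Docking

open Literature.NumberTheory.Automorphic Literature.NumberTheory.Automorphic.UnitaryGroup
open Summit.HodgeConjecture.HodgeConjecture.Cruxes.HLiu418.K2LiuDoublingUnfoldBridge

variable (L : Type) [Field L] [NumberField L] [IsCMField L] {N : ℕ} (H : Matrix (Fin N) (Fin N) L)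
  (dV : Fin N → L) (t : L) (ht : t ≠ 0) (g : GL (Fin N) L)
  (hg : formCongr ((IsCMField.complexConj L : L ≃ₐ[↥(maximalRealSubfield L)] L) : L →+* L) g (t • H) = Matrix.diagonal dV)
  (ιA : (adelicGroupData (↥(maximalRealSubfield L)) L (IsCMField.complexConj L) N H).Adelic →*
    ↥(UnitaryGroup.adelic (↥(maximalRealSubfield L)) L (IsCMField.complexConj L) N (Matrix.diagonal dV)))
  (hιA : ∀ k, ((ιA k : ↥(UnitaryGroup.adelic (↥(maximalRealSubfield L)) L (IsCMField.complexConj L) N (Matrix.diagonal dV))) :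
        GL (Fin N) (AdeleRing (𝓞 L) L)) =
      (toAdeleGL L g)⁻¹ * adelicVal (↥(maximalRealSubfield L)) L (IsCMField.complexConj L) N H k * toAdeleGL L g)

/-! ## §1 The similitude behind `ιA`, in the shape ★ `localCongr` ∕ ★ `finAdelicCongr` consume -/

include ht hg in
/-- `ᵗc(g⁻¹) · (t⁻¹ • diagonal dV) · g⁻¹ = H` (from `hg`; ★ `simil_inv_of_formCongr` + ★ `formCongr_inv_smul_of_simil`). [cite: PlatonovRapinchuk1994, §2.3] -/
theorem formCongr_inv_diagonal :
    formCongr ((IsCMField.complexConj L : L ≃ₐ[↥(maximalRealSubfield L)] L) : L →+* L) g⁻¹ (t⁻¹ • Matrix.diagonal dV) = H :=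
  formCongr_inv_smul_of_simil L N (Matrix.diagonal dV) H t ht g⁻¹ (simil_inv_of_formCongr L H dV t g hg)

/-! ## §2 The finite part of `ιA` -/

include ht hg hιA in
/-- **`(ιA x)_f = ĝ_f⁻¹ · x_f · ĝ_f`**, i.e. `finPart (ιA x) = finAdelicCongr … g⁻¹ … (finPart x)` (★ (K5) `finPart_similCongr` for the value-characterised
`Φ = ιA` of ★ H5 and `Φf = finAdelicCongr`). [cite: PlatonovRapinchuk1994, §2.3, §5.1] [cite: BorelJacquet1979, §4.1] -/
theorem finPart_iotaA (x : (adelicGroupData (↥(maximalRealSubfield L)) L (IsCMField.complexConj L) N H).Adelic) :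
    finPart (↥(maximalRealSubfield L)) L (IsCMField.complexConj L) N (Matrix.diagonal dV) (ιA x) =
      finAdelicCongr (↥(maximalRealSubfield L)) L (IsCMField.complexConj L) g⁻¹ (inv_ne_zero ht)
        (formCongr_inv_diagonal L H dV t ht g hg) (finPart (↥(maximalRealSubfield L)) L (IsCMField.complexConj L) N H x) := by
  obtain ⟨Φ, hΦv, hΦ⟩ := exists_continuousMulEquiv_eq_iotaA L H dV t ht g hg ιA hιA
  rw [← hΦ x]
  exact finPart_similCongr L N (Matrix.diagonal dV) H g⁻¹ Φ hΦv
    (finAdelicCongr (↥(maximalRealSubfield L)) L (IsCMField.complexConj L) g⁻¹ (inv_ne_zero ht) (formCongr_inv_diagonal L H dV t ht g hg))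
    (fun z => coe_finAdelicCongr_apply (↥(maximalRealSubfield L)) L (IsCMField.complexConj L) g⁻¹ (inv_ne_zero ht)
      (formCongr_inv_diagonal L H dV t ht g hg) z) x

include ht hg hιA in
/-- **`(ιA x)_v = localCongr_v (x_v)`** at every finite place `v` of `L⁺`: the `v`-component of the docked element is the ★ local congruence
`u ↦ g⁻¹ u g` applied to the `v`-component (§2 + ★ (P1) `evalPlace_finAdelicCongr`).  This is the identity that moves every place-`v` object of the
#34 dictionary between the `U(H)`-side (★ #29s) and the `U(diagonal dV)`-side (★ #28s, ★ D7, ★ #31s). [cite: PlatonovRapinchuk1994, §2.3, §5.1] -/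
theorem evalPlace_finPart_iotaA (x : (adelicGroupData (↥(maximalRealSubfield L)) L (IsCMField.complexConj L) N H).Adelic)
    (v : HeightOneSpectrum (𝓞 ↥(maximalRealSubfield L))) :
    evalPlace (↥(maximalRealSubfield L)) L (IsCMField.complexConj L) N (Matrix.diagonal dV) v
        (finPart (↥(maximalRealSubfield L)) L (IsCMField.complexConj L) N (Matrix.diagonal dV) (ιA x)) =
      localCongr L (IsCMField.complexConj L) g⁻¹ (inv_ne_zero ht) (formCongr_inv_diagonal L H dV t ht g hg) v
        (evalPlace (↥(maximalRealSubfield L)) L (IsCMField.complexConj L) N H v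
          (finPart (↥(maximalRealSubfield L)) L (IsCMField.complexConj L) N H x)) := by
  rw [finPart_iotaA L H dV t ht g hg ιA hιA x, evalPlace_finAdelicCongr]

/-! ## §3 The archimedean part of `ιA` -/

include ht hg hιA in
/-- **`(ιA x)_∞ = Φ∞ (x_∞)`** for an isomorphism of topological groups `Φ∞ : U(H)(L⁺ ⊗ ℝ) ≃ₜ* U(diagonal dV)(L⁺ ⊗ ℝ)` acting by `y ↦ (g⁻¹ ⊗ 1) y (g⁻¹ ⊗ 1)⁻¹`
(★ (K0∞) `exists_archSimilCongr` + ★ (K4) `archPart_similCongr`). [cite: PlatonovRapinchuk1994, §2.3] [cite: BorelJacquet1979, §4.1] -/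
theorem exists_archCongr_archPart_iotaA :
    ∃ Φi : ↥(arch (↥(maximalRealSubfield L)) L (IsCMField.complexConj L) N H) ≃ₜ*
        ↥(arch (↥(maximalRealSubfield L)) L (IsCMField.complexConj L) N (Matrix.diagonal dV)),
      (∀ y : ↥(arch (↥(maximalRealSubfield L)) L (IsCMField.complexConj L) N H),
        ((Φi y : ↥(arch (↥(maximalRealSubfield L)) L (IsCMField.complexConj L) N (Matrix.diagonal dV))) : GL (Fin N) (mixedSpace L)) =
          Matrix.GeneralLinearGroup.map (mixedEmbedding L) g⁻¹ * (y : GL (Fin N) (mixedSpace L)) *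
            (Matrix.GeneralLinearGroup.map (mixedEmbedding L) g⁻¹)⁻¹) ∧
      ∀ x : (adelicGroupData (↥(maximalRealSubfield L)) L (IsCMField.complexConj L) N H).Adelic,
        archPart (↥(maximalRealSubfield L)) L (IsCMField.complexConj L) N (Matrix.diagonal dV) (ιA x) =
          Φi (archPart (↥(maximalRealSubfield L)) L (IsCMField.complexConj L) N H x) := by
  obtain ⟨Φ, hΦv, hΦ⟩ := exists_continuousMulEquiv_eq_iotaA L H dV t ht g hg ιA hιA
  obtain ⟨Φi, hΦi⟩ := exists_archSimilCongr L N (Matrix.diagonal dV) H t ht g⁻¹ (simil_inv_of_formCongr L H dV t g hg)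
  refine ⟨Φi, hΦi, fun x => ?_⟩
  rw [← hΦ x]
  exact archPart_similCongr L N (Matrix.diagonal dV) H g⁻¹ Φ hΦv Φi hΦi x

/-! ## §4 The hyperspecial subgroups correspond off a finite set -/

include ht hg in
/-- Off a finite set of places, `localCongr_v u ∈ U(diagonal dV)(𝒪_v) ↔ u ∈ U(H)(𝒪_v)` (★ (P2) `eventually_localCongr_mem_localInt_iff`, in this file's frame).
[cite: PlatonovRapinchuk1994, §5.1] -/
theorem eventually_localCongr_mem_localInt_iff_inv :
    ∀ᶠ v : HeightOneSpectrum (𝓞 ↥(maximalRealSubfield L)) in cofinite,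
      ∀ u : ↥(localPi L (IsCMField.complexConj L) N H v),
        localCongr L (IsCMField.complexConj L) g⁻¹ (inv_ne_zero ht) (formCongr_inv_diagonal L H dV t ht g hg) v u ∈
            localInt L (IsCMField.complexConj L) N (Matrix.diagonal dV) v ↔
          u ∈ localInt L (IsCMField.complexConj L) N H v :=
  eventually_localCongr_mem_localInt_iff (↥(maximalRealSubfield L)) L (IsCMField.complexConj L) g⁻¹ (inv_ne_zero ht)
    (formCongr_inv_diagonal L H dV t ht g hg)

end Summit.HodgeConjecture.HodgeConjecture.Cruxes.HLiu418.K2LiuDoublingZetaGL1Docking
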